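import Mathlib
import HarnessLib
import Literature.NumberTheory.Transcendental.PennerWeilPeterssonVolumesProofs
import Summits.RiemannHypothesis.RiemannHypothesis.Theorems.EarlyAppointmentsRemainder0XiLogIntegrals

/-!
# Truncation Bound Helpers for Far Log-Kernel Estimates

This file provides helper lemmas for bounding truncation errors in the far log-kernel
integral estimates used in the Remainder0Xi crux.

## Main Result

`truncation_bound_near_zero`: For ε ≤ 1/2, the integral |∫₀^ε log(v)/(1-v²)| ≤ 2ε(1 - log ε).
This bounds the error from truncating the (0,1) integral at the lower end.

## References

Supports stmt-RiemannHypothesis-24730 (Remainder0Xi crux).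
-/

set_option linter.dupNamespace false
namespace Summit.RiemannHypothesis.RiemannHypothesis.Theorems.EarlyAppointmentsRemainder0Xi.Helpers

open scoped BigOperators Topology Classical
open Real Complex MeasureTheory Set Filter

-- Import the integrable_of_lintegral_ofReal_ne_top from the log integrals file
open Summit.RiemannHypothesis.RiemannHypothesis.Theorems.EarlyAppointmentsRemainder0Xi

/-- The truncation error from [0, ε] is bounded by 2ε(1 - log ε).

For ε ≤ 1/2, we have:
- 1/(1-ε²) ≤ 4/3 < 2
- The integrand log(v)/(1-v²) is negative on (0,ε)
- |∫₀^ε log(v)/(1-v²)| ≤ (1/(1-ε²)) · ε(1-log ε) ≤ 2ε(1-log ε)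

Uses `intervalIntegral.integral_log`: ∫ s in a..b, log s = b log b - a log a - b + a. -/
theorem truncation_bound_near_zero {ε : ℝ} (hε0 : 0 < ε) (hε1 : ε ≤ 1 / 2) :
    |∫ v in Ioo (0 : ℝ) ε, Real.log v / (1 - v ^ 2)| ≤ 2 * ε * (1 - Real.log ε) := by
  have h_eps_sq : ε ^ 2 ≤ 1 / 4 := by nlinarith
  have h_denom : 3 / 4 ≤ 1 - ε ^ 2 := by linarith
  have h_denom_pos : 0 < 1 - ε ^ 2 := by linarith
  have h_inv_bound : (1 - ε ^ 2)⁻¹ ≤ 4 / 3 := by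
    rw [inv_le_comm₀ h_denom_pos (by norm_num : (0:ℝ) < 4/3)]
    linarith
  have h_lt_2 : (1 - ε ^ 2)⁻¹ < 2 := by linarith
  have h_neg : ∀ v ∈ Ioo (0 : ℝ) ε, Real.log v / (1 - v ^ 2) ≤ 0 := fun v hv => by
    apply div_nonpos_of_nonpos_of_nonneg
    · have hv_lt_1 : v < 1 := hv.2.trans_le (hε1.trans (by norm_num))
      exact Real.log_nonpos hv.1.le hv_lt_1.le
    · have hv1 : v < 1 := hv.2.trans_le (hε1.trans (by norm_num))
      nlinarith [hv.1, hv1]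
  have h_abs : |∫ v in Ioo (0 : ℝ) ε, Real.log v / (1 - v ^ 2)| =
               -(∫ v in Ioo (0 : ℝ) ε, Real.log v / (1 - v ^ 2)) := by
    rw [abs_of_nonpos]
    apply setIntegral_nonpos measurableSet_Ioo
    exact fun v hv => h_neg v hv
  rw [h_abs, ← integral_neg]
  have hpt : ∀ v ∈ Ioo (0 : ℝ) ε, -Real.log v / (1 - v ^ 2) ≤ -Real.log v / (1 - ε ^ 2) := by
    intro v hv
    have hv_pos : 0 < v := hv.1
    have hv_lt : v < ε := hv.2
    have hv_sq : v ^ 2 < ε ^ 2 := sq_lt_sq' (by linarith) hv_lt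
    have h_denom_v : 0 < 1 - v ^ 2 := by nlinarith
    have h_denom_eps : 0 < 1 - ε ^ 2 := h_denom_pos
    have h_le : 1 - ε ^ 2 ≤ 1 - v ^ 2 := by linarith
    have h_neg_log : 0 ≤ -Real.log v := by
      apply neg_nonneg.mpr
      have heps_lt_1 : ε ≤ 1 := hε1.trans (by norm_num : (1:ℝ)/2 ≤ 1)
      have hv1 : v ≤ 1 := hv_lt.le.trans heps_lt_1
      exact Real.log_nonpos hv_pos.le hv1
    exact div_le_div_of_nonneg_left h_neg_log h_denom_eps h_le
  have h_1_minus_log_eps_nonneg : 0 ≤ 1 - Real.log ε := by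
    have hlog : Real.log ε ≤ 0 := Real.log_nonpos hε0.le (hε1.trans (by norm_num))
    linarith
  have hsubset : Ioo (0 : ℝ) ε ⊆ Ioo 0 1 := by
    intro v hv
    exact ⟨hv.1, hv.2.trans_le (hε1.trans (by norm_num))⟩
  have hint_01 : IntegrableOn (fun v => -Real.log v / (1 - v ^ 2)) (Ioo (0 : ℝ) 1) := by
    rw [IntegrableOn]
    apply integrable_of_lintegral_ofReal_ne_top
    · exact (Real.measurable_log.neg).div (measurable_const.sub (measurable_id.pow_const 2))
    · rw [Literature.NumberTheory.Transcendental.lintegral_neg_log_div_one_sub_sq]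
      exact ENNReal.ofReal_ne_top
    · have h0 : ∀ v ∈ Ioo (0 : ℝ) 1, 0 ≤ -Real.log v / (1 - v ^ 2) := fun v hv => by
        apply div_nonneg
        · exact neg_nonneg.2 (Real.log_nonpos hv.1.le hv.2.le)
        · nlinarith [hv.1, hv.2]
      have hae : ∀ᵐ v ∂(volume.restrict (Ioo 0 1)), ENNReal.ofReal (-(-Real.log v / (1 - v ^ 2))) = 0 := by
        filter_upwards [ae_restrict_mem measurableSet_Ioo] with v hv
        have heq : -(-Real.log v / (1 - v ^ 2)) = Real.log v / (1 - v ^ 2) := by ring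
        rw [heq, ENNReal.ofReal_eq_zero]
        apply div_nonpos_of_nonpos_of_nonneg
        · exact Real.log_nonpos hv.1.le hv.2.le
        · nlinarith [hv.1, hv.2]
      rw [lintegral_congr_ae hae, lintegral_zero]; exact ENNReal.zero_ne_top
  have hint_eps : IntegrableOn (fun v => -Real.log v / (1 - v ^ 2)) (Ioo (0 : ℝ) ε) :=
    hint_01.mono_set hsubset
  have hint_const : IntegrableOn (fun v => -Real.log v / (1 - ε ^ 2)) (Ioo (0 : ℝ) ε) := by
    have hmeas : AEStronglyMeasurable (fun v => -Real.log v / (1 - ε ^ 2)) (volume.restrict (Ioo 0 ε)) :=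
      (Real.measurable_log.neg.div_const (1 - ε ^ 2)).aestronglyMeasurable
    refine ⟨hmeas, ?_⟩
    have hbound : ∀ᵐ v ∂(volume.restrict (Ioo 0 ε)), ‖-Real.log v / (1 - ε ^ 2)‖ ≤ (4/3) * ‖-Real.log v / (1 - v ^ 2)‖ := by
      filter_upwards [ae_restrict_mem measurableSet_Ioo] with v hv
      have hv_pos : 0 < v := hv.1
      have hv_lt : v < ε := hv.2
      have heps_lt_1 : ε ≤ 1 := hε1.trans (by norm_num)
      have hv1 : v < 1 := hv_lt.trans_le heps_lt_1
      have hdenom_v : 0 < 1 - v ^ 2 := by nlinarith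
      have h_neg_log : 0 ≤ -Real.log v := neg_nonneg.2 (Real.log_nonpos hv_pos.le hv1.le)
      have hv_sq : v ^ 2 < ε ^ 2 := sq_lt_sq' (by linarith) hv_lt
      have h_denom_le : 1 - ε ^ 2 ≤ 1 - v ^ 2 := by linarith
      rw [Real.norm_eq_abs, Real.norm_eq_abs]
      rw [abs_of_nonneg (div_nonneg h_neg_log h_denom_pos.le)]
      rw [abs_of_nonneg (div_nonneg h_neg_log hdenom_v.le)]
      have h_ratio : (1 - v ^ 2) / (1 - ε ^ 2) ≤ 4 / 3 := by
        have h1 : 1 - v ^ 2 ≤ 1 := by nlinarith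
        calc (1 - v ^ 2) / (1 - ε ^ 2) ≤ 1 / (1 - ε ^ 2) := by
              apply div_le_div_of_nonneg_right h1 h_denom_pos.le
          _ = (1 - ε ^ 2)⁻¹ := by rw [one_div]
          _ ≤ 4 / 3 := h_inv_bound
      calc -Real.log v / (1 - ε ^ 2)
          = -Real.log v / (1 - v ^ 2) * ((1 - v ^ 2) / (1 - ε ^ 2)) := by
            field_simp [hdenom_v.ne', h_denom_pos.ne']
        _ ≤ -Real.log v / (1 - v ^ 2) * (4 / 3) := by
            apply mul_le_mul_of_nonneg_left h_ratio (div_nonneg h_neg_log hdenom_v.le)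
        _ = (4/3) * (-Real.log v / (1 - v ^ 2)) := by ring
    have hbound' : ∀ᵐ v ∂(volume.restrict (Ioo 0 ε)), ‖-Real.log v / (1 - ε ^ 2)‖ ≤ ‖(4/3) * (-Real.log v / (1 - v ^ 2))‖ := by
      filter_upwards [hbound] with v hv
      have h43 : (0 : ℝ) ≤ 4 / 3 := by norm_num
      rw [norm_mul, Real.norm_of_nonneg h43]
      exact hv
    exact (hint_eps.2.const_mul (4/3)).mono hbound'
  have hmono := setIntegral_mono_on hint_eps hint_const measurableSet_Ioo hpt
  have hintegrand_eq : ∀ v, -(Real.log v / (1 - v ^ 2)) = -Real.log v / (1 - v ^ 2) := fun v => by ring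
  have hintegral_eq : ∫ v in Ioo 0 ε, -(Real.log v / (1 - v ^ 2)) = ∫ v in Ioo 0 ε, -Real.log v / (1 - v ^ 2) := by
    congr 1; ext v; exact hintegrand_eq v
  rw [hintegral_eq]
  calc ∫ v in Ioo 0 ε, -Real.log v / (1 - v ^ 2)
      ≤ ∫ v in Ioo 0 ε, -Real.log v / (1 - ε ^ 2) := hmono
    _ ≤ 2 * ε * (1 - Real.log ε) := by
        have hfactor : ∫ v in Ioo 0 ε, -Real.log v / (1 - ε ^ 2) =
            (1 - ε ^ 2)⁻¹ * ∫ v in Ioo 0 ε, -Real.log v := by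
          simp_rw [div_eq_inv_mul]
          rw [← MeasureTheory.integral_const_mul]
        have hlog_integral : ∫ v in Ioo 0 ε, -Real.log v ≤ ε * (1 - Real.log ε) := by
          have hbound : ∫ v in Ioo 0 ε, -Real.log v ≤ ε * (1 - Real.log ε) := by
            rw [← integral_Ioc_eq_integral_Ioo, ← intervalIntegral.integral_of_le hε0.le]
            rw [intervalIntegral.integral_neg, integral_log]
            simp only [zero_mul, sub_zero]
            ring_nf
            exact le_refl _
          exact hbound
        rw [hfactor]
        calc (1 - ε ^ 2)⁻¹ * ∫ v in Ioo 0 ε, -Real.log v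
            ≤ (1 - ε ^ 2)⁻¹ * (ε * (1 - Real.log ε)) := by
              apply mul_le_mul_of_nonneg_left hlog_integral (inv_nonneg.mpr h_denom_pos.le)
          _ ≤ 2 * (ε * (1 - Real.log ε)) := by
              apply mul_le_mul_of_nonneg_right h_lt_2.le
              apply mul_nonneg hε0.le h_1_minus_log_eps_nonneg
          _ = 2 * ε * (1 - Real.log ε) := by ring

end Summit.RiemannHypothesis.RiemannHypothesis.Theorems.EarlyAppointmentsRemainder0Xi.Helpers
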